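import Mathlib
import HarnessLib
import Literature.Analysis.FluidPDE.Tao2016AveragedNS.TaylorChainCertificate
import Summits.NavierStokesRegularity.NavierStokesRegularity.Theorems.TaylorModelRungThreeReadoutFlowVar
import Summits.NavierStokesRegularity.NavierStokesRegularity.Theorems.TaylorModelRungThreeReadoutStubDefs

/-!
# Line `taylor-model` on crux K1b-DR (stmt-NavierStokesRegularity-23954) — stub G0i ASSEMBLED:
# `Valid → TaylorModelSoundness → ∃ φ, IsFlowPackage cd φ`

The flow package of the reshaped skeleton (v4, line owner ns-idea-2 g3; statement side
`…TaylorModelRungThreeReadoutPackage`): for a valid certificate `cd` and the abstract soundness S1, the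
stage-wise window flows given by S1 (`exists_windowPack`, helper `…ReadoutFlow`), lifted to K1b-DR's shape
(`liftFlow`), form a flow package: (F0)–(F3) from `…ReadoutFlow`, (F4)–(F5) from `…ReadoutFlowVar`, the
per-stage data (positive weights, `0 ≤ bb j`, the weighted bilinear bound (B)) from `StageNumerics`, the
per-sub-step data (centre bounds, guards, jet recursions of `P` / `Wv`) from `Chain`.

* `stub_flow : FlowPackageExists` — the registered stub G0i of skeleton v4 (`a500375dfcc940c7`) BY NAME
  (`FlowPackageExists := ∀ cd, cd.Valid → TaylorModelSoundness → ∃ φ, IsFlowPackage cd φ`, tree def in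
  `…ReadoutStubDefs`).

MODEL-lattice bookkeeping only (rung TL-M3); nothing here is a statement about the Navier–Stokes equations.
-/

noncomputable section

-- the sub-problem namespace repeats the summit name by design (D-0017)
set_option linter.dupNamespace false

namespace Summit.NavierStokesRegularity.NavierStokesRegularity.Theorems.TaylorModelReadout

open scoped BigOperators
open Set Finset Literature.Analysis.FluidPDE.TaoCascade Literature.Analysis.FluidPDE.TaoCascade.TaylorChain
open Summit.NavierStokesRegularity.NavierStokesRegularity.Theorems.TaylorModel

/-- **Stub G0i `stub_flow : FlowPackageExists`.** A valid certificate and the abstract Taylor-model soundness S1 give a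
flow package: S1 instantiated per stage in window coordinates and lifted to cascade coordinates.
[folklore; cite: BerzMakino1998, §2–3] -/
theorem stub_flow : FlowPackageExists := by
  intro cd hV hS
  obtain ⟨-, hN, hC, -⟩ := hV
  -- per-stage hypotheses of S1
  have hω : ∀ j, j ≤ cd.N₀ → ∀ k, 0 < cd.ω j k := fun j hj => (hN.1 j hj).2.2.2.2.2.2.1
  have hbb : ∀ j, j ≤ cd.N₀ → 0 ≤ cd.bb j := fun j hj => (hN.2 j hj).1
  have hB : ∀ j, j ≤ cd.N₀ → ∀ (u v : Fin 4 → ℤ → ℝ) (Nu Nv : ℝ), 0 ≤ Nu → 0 ≤ Nv →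
      cd.InBall j u Nu → cd.InBall j v Nv → cd.InBall j (cd.Qb u v) (cd.bb j * Nu * Nv) :=
    fun j hj => (hN.2 j hj).2
  -- the stage-wise window flows
  have hex : ∀ j, j ≤ cd.N₀ → ∃ Φ : (Fin (nW cd) → ℝ) → ℝ → Fin (nW cd) → ℝ, WindowPack cd j Φ :=
    fun j hj => exists_windowPack cd hS (hω j hj) (hbb j hj) (hB j hj)
  set Φw : ℕ → (Fin (nW cd) → ℝ) → ℝ → Fin (nW cd) → ℝ := fun j =>
    if h : j ≤ cd.N₀ then Classical.choose (hex j h) else fun _ _ _ => 0 with hΦw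
  have hP : ∀ j, j ≤ cd.N₀ → WindowPack cd j (Φw j) := by
    intro j hj
    simp only [hΦw, dif_pos hj]
    exact Classical.choose_spec (hex j hj)
  refine ⟨fun j => liftFlow cd (Φw j), fun j hj => ⟨?_, ?_, ?_, ?_, ?_, ?_⟩⟩
  · -- (F0)
    intro z i k hk t
    exact liftFlow_off_window z i hk t
  · -- (F1)
    intro z m T hm hz hT hg
    exact ⟨solvesOn_liftFlow (hP j hj) hm hz hT hg,
      fun t ht => inBall_stAt_liftFlow (hP j hj) hm hz hT hg ht⟩
  · -- (F2)
    intro z T ψ hT hψ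
    exact liftFlow_unique (hP j hj) hT hψ
  · -- (F3)
    intro x v m ρ T hm hρ hx hv hT hg t ht
    exact inBall_stAt_liftFlow_sub (hP j hj) (hbb j hj) hm hρ hx hv hT hg ht
  · -- (F4)
    intro x m ρ T hm hρ hx hT hg z z' dd hz hz' hzz i k hk1 hk2 t' ht'
    exact liftFlow_segment_deriv (hP j hj) (hω j hj) (hbb j hj) hm hρ hx hT hg hz hz' hzz i hk1 hk2 ht'
  · -- (F5): per sub-step data from `Chain`
    intro s hs
    obtain ⟨-, -, -, -, -, -, hA, hBs⟩ := hC j hj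
    obtain ⟨-, -, a3, a4, -, a6, a7, a8, a9, -, -, -, -, -, -, -, a17, a18, a19, a20⟩ := hA s hs.le
    obtain ⟨b1, b2, b3, -⟩ := hBs s hs
    have hρO : 0 ≤ cd.ρO j s := by linarith
    have hPj : ∀ n, n ≤ cd.pdeg → toVec cd (cd.P j s n) = taylorJet (Qw cd) (toVec cd (cd.x j s)) n :=
      toVec_table_eq_taylorJet a17 a18
    have hWj : ∀ (v : Fin 4 → ℤ → ℝ) n, n ≤ cd.pdeg →
        toVec cd (cd.Wv j s n v) = varJet (Qw cd) (toVec cd (cd.x j s)) (toVec cd v) n :=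
      fun v => toVec_varTable_eq_varJet (W := fun n => cd.Wv j s n v) hPj (a19 v) (fun n hn i k => a20 n hn v i k)
    refine ⟨?_, ?_, ?_⟩
    · intro u hu
      exact liftFlow_TP_bound (hP j hj) a3 a4 b1.le b2 hPj hu
    · intro v ρ' hρ' hle hv _ u hu
      exact liftFlow_Vap_bound (hP j hj) (hω j hj) (hbb j hj) a3 a4 b1.le b3 hWj hρ' hle hv hu
    · intro y y' dd hy hy' hyy _ u hu
      exact liftFlow_twoPoint_bound (hP j hj) (hω j hj) (hbb j hj) a3 a4 hρO b1.le b3 hWj hy hy' hyy hu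

end Summit.NavierStokesRegularity.NavierStokesRegularity.Theorems.TaylorModelReadout

end
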